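import Summits.QuantumAdvantage.QuantumAdvantage.Theses.SpinorFlattening
import Summits.QuantumAdvantage.QuantumAdvantage.Theorems.SpinorFlatteningNegApproxGaussRankSuperpoly
import Literature.Computability.QuantumComplexity.GaussianRank

/-!
# Support item `SpinorFlattening.FlatteningBoundExact` (stmt-QuantumAdvantage-1249)

The `δ = 0` core of the Clifford-multiplication flattening bound on the spinor island:
for all `t K r` with `r · D_K(4t) < C(t,K) · 8^K` (where `D_K(N) = Σ_{j ≤ K, j ≡ K (2)} C(N,j)` is the
normal-ordering deficiency `flatteningDeficiency K N`), the matchgate-magic power `|M⟩^{⊗t}` is NOT a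
linear combination of `r` fermionic Gaussian states.

## Proof
The composition reuses, by import, the four part theorems landed for the kill crux
`NegApproxGaussRankSuperpoly` (stmt-QuantumAdvantage-1245, file
`Theorems/SpinorFlatteningNegApproxGaussRankSuperpoly.lean` and its stub files):

* `deficiency` — for Gaussian `g₁ … g_r` there is ONE subspace `W` with `dim W ≤ r · D_K(4t)` containing
  every degree-`K` Majorana-word image of `φ = Σ aᵢ gᵢ` (CAR normal ordering);
* `flatOrthonormal` — the one-Majorana-per-block monomial images of `|M⟩^{⊗t}` are orthonormal;
* `stub_massBound` — Bessel: `|ι| − dim W ≤ |ι| · ‖ψ − φ‖²` for a unitary family with orthonormal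
  images of `ψ` and images of `φ` inside `W`;
* `countGap_choose_mul_pow_le_card` — the degree-`K` flat family `𝔉_K` (block patterns exciting exactly
  `K` of the `t` blocks) has at least `C(t,K) · 8^K` members.

If `|M⟩^{⊗t} = φ` then `‖ψ − φ‖² = 0`, so the mass bound gives `|𝔉_K| ≤ dim W ≤ r · D_K(4t) < C(t,K) · 8^K
≤ |𝔉_K|`, a contradiction.  No singular values and no real analysis beyond `normSq 0 = 0` are used.

The route's inline `maj` / `IsGauss` / `Mpow` / deficiency sum are definitionally the tree's
`majorana` / `IsGaussian` / `magicMPow` / `flatteningDeficiency` (GaussianRank.lean), so the statement is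
restated over the named API by `show`.
-/

set_option linter.dupNamespace false -- D-0017: single-problem summit ⇒ `QuantumAdvantage.QuantumAdvantage` by design

noncomputable section

namespace Summit.QuantumAdvantage.QuantumAdvantage.Theorems.SpinorFlattening

open Matrix Finset
open Literature.Computability.QuantumComplexity Literature.Computability.Cryptography

/-- **Support item `SpinorFlattening.FlatteningBoundExact` (stmt-QuantumAdvantage-1249)**, the `δ = 0`
core of the flattening bound: if `r · D_K(4t) < C(t,K) · 8^K` then `|M⟩^{⊗t}` is not a linear combination
of `r` Gaussian states on `4t` qubits.  Consequently the exact Gaussian rank satisfies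
`χ_G(|M⟩^{⊗t}) ≥ max_K ⌈C(t,K) 8^K / D_K(4t)⌉`. -/
theorem FlatteningBoundExact_proof :
    Summit.QuantumAdvantage.QuantumAdvantage.Theses.SpinorFlattening.FlatteningBoundExact := by
  classical
  show ∀ t K r : ℕ, r * flatteningDeficiency K (t * 4) < t.choose K * 8 ^ K →
    ∀ (a : Fin r → ℂ) (g : Fin r → QReg (t * 4) → ℂ), (∀ i, IsGaussian (g i)) →
      magicMPow t ≠ ∑ i, a i • g i
  intro t K r hcount a g hg heq
  -- the flat family: labels, monomials, index type
  let lab : (Fin t → Option (Fin 4 × Bool)) → List (Fin (t * 4) × Bool) := fun s =>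
    (List.finRange t).filterMap fun b => (s b).map fun q => (finProdFinEquiv (b, q.1), q.2)
  let mono : (Fin t → Option (Fin 4 × Bool)) → Matrix (QReg (t * 4)) (QReg (t * 4)) ℂ := fun s =>
    ((List.finRange t).filterMap fun b =>
      (s b).map fun q => majorana (t * 4) (finProdFinEquiv (b, q.1)) q.2).prod
  have hmono_lab : ∀ s, mono s = ((lab s).map fun p => majorana (t * 4) p.1 p.2).prod := by
    intro s
    simp only [mono, lab, List.map_filterMap, Option.map_map]
    rfl
  let ι : Type := {s : Fin t → Option (Fin 4 × Bool) // (univ.filter fun b => (s b).isSome).card = K}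
  -- deficiency: one subspace W of dimension ≤ r·D_K(4t) holds every degree-K monomial image of φ
  obtain ⟨W, hW, hmem⟩ := deficiency (t * 4) K r a g hg
  -- unitarity of the monomials
  have hunit : ∀ s, mono s ∈ Matrix.unitaryGroup (QReg (t * 4)) ℂ := by
    intro s
    rw [hmono_lab]
    refine list_prod_mem ?_
    intro x hx
    obtain ⟨p, -, rfl⟩ := List.mem_map.1 hx
    exact majorana_mem_unitaryGroup _ _ _
  -- orthonormality of the images of M^{⊗t}
  obtain ⟨hO1, hO2⟩ := flatOrthonormal t mono (fun s => rfl)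
  -- mass bound for the degree-K family
  have hmass := stub_massBound (t * 4) ι (fun s => mono s.1) (magicMPow t) (∑ i, a i • g i) W
    (fun s => hunit s.1) (fun s => hO1 s.1)
    (fun s s' hss' => hO2 s.1 s'.1 fun h => hss' (Subtype.ext h))
    (fun s => by
      show mono s.1 *ᵥ _ ∈ W
      rw [hmono_lab]
      exact hmem (lab s.1) ((length_filterMap_labels t s.1).trans s.2))
  -- exactness: the distance vanishes, so the whole family mass sits inside W
  have h0 : normSq (magicMPow t - ∑ i, a i • g i) = 0 := by
    rw [← heq, sub_self]
    simp [normSq]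
  rw [h0, mul_zero, sub_nonpos] at hmass
  have hcardW : Fintype.card ι ≤ Module.finrank ℂ W := by exact_mod_cast hmass
  -- counting: |𝔉_K| ≤ dim W ≤ r · D_K(4t) < C(t,K) · 8^K ≤ |𝔉_K|
  have hlt : Fintype.card ι < Fintype.card ι :=
    calc Fintype.card ι ≤ Module.finrank ℂ W := hcardW
      _ ≤ r * flatteningDeficiency K (t * 4) := hW
      _ < t.choose K * 8 ^ K := hcount
      _ ≤ Fintype.card ι := countGap_choose_mul_pow_le_card t K
  exact lt_irrefl _ hlt

end Summit.QuantumAdvantage.QuantumAdvantage.Theorems.SpinorFlattening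

end
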